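import Mathlib.Data.Real.Basic
import Mathlib.Tactic
import Literature.Probability.LatticeModels.LatticeGraph
import HarnessLib

/-!
# DAG node N07 (road R0′ at the record; OPEN junction «`hker` ∕ `hpos` at the record = (P)_D»):
# THE ENERGY IDENTITY and «cluster criterion ⇒ (P)_D» on the discrete torus, for an ARBITRARY tiling

Width seat `pub-ymgap-dag-n07-w7` (g3), count-neutral helper (`--supports … --as helper`).

The multi-level point-feasibility lemma (P)_D (lane note LOCATED-POINT-FEASIBILITY, dag-n07-e g20 §5, OPEN):
on the torus, if a scalar `μ` takes ONE value `h` on the centres of all tiles of a tiling and `Δ²μ` is constant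
on every tile, then `μ ≡ h`.  This file types the NESTING-AGNOSTIC SHELL of the tile ∕ cluster route of
LOCATED-PD-TILE-CRITERION (dag-n07-w7 g2, §2–§3): nothing depends on cubes, block sides, levels or translation
invariance — a "tiling" is any `tile : TorusSite d N → τ` with "centres" `ctr : τ → TorusSite d N`, a cluster
structure any `clu : TorusSite d N → σ`.
* §1 finite differences on `TorusSite d N = Fin d → ZMod N` (the tree's torus, `LatticeGraph`): `fd`, `bd` along
  `Pi.single i 1`, the Laplacian `lap`, summation by parts, symmetry of `lap`, `Σ lap = 0`, the Dirichlet form,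
  ★ the HESSIAN IDENTITY `Σ_x (Δf x)² = Σ_x Σ_{i,j} (∂ᵢ∂ⱼ f x)²` (`sum_lap_sq_eq_sum_hess_sq`, forward-corner
  split; diagonal terms re-centre by `sum_fd_fd_sq_eq_sum_bd_fd_sq`).
* §2 rigidity: difference-free ⇒ constant; ★ Hessian-free ⇒ constant (`const_of_hess_eq_zero`, characteristic
  `0`); `Δf = 0 ⇒` constant; `Δ²f = 0 ⇒` constant (real).
* §3 ★★ `energy_identity`: `‖Δμ‖² = Σ_x β(tile x)·(μ x − μ(ctr (tile x)))` whenever `μ (ctr t) = h` for all `t`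
  and `Δ²μ x = β (tile x)`; `energy_identity_hess`; ★★★ `pointFeasibility_of_clusterCriterion`: if every
  `Φ_s(μ) = Σ_{clu x = s} (Σ_{i,j}(∂ᵢ∂ⱼμ x)² − β(tile x)(μ x − μ(ctr(tile x))))` is `≥ 0`, with equality only
  when the Hessian of `μ` vanishes on `s`, then `μ ≡ h`; `pointFeasibility_of_localCriterion` (same for ANY
  density `e` with `Σ e = ‖Δμ‖²`, equality case `Δμ = 0` on the cluster); the global form
  `pointFeasibility_of_kPositivity`.  The criterion is asked AT `μ` (weakest form); the note's (C_{ℓ,d}) ∕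
  (C^clu_{ℓ,k,d}) are its uniform-in-`μ` versions per tile ∕ cluster shape.  The binders are inhabited trivially by
  the singleton tiling (`tile = ctr = id`, every `Φ_s` a sum of squares) and by every constant `μ`.

HONEST SCOPE.  Lattice bookkeeping; asserts NOTHING about [B11]∕[B6]∕[3]; proves (P)_D for NO Bałaban geometry
by itself (single-scale criteria in `d = 4` OPEN: per tile ✗, `2⁴`-cluster ✗ up to `ℓ = 9`, `3⁴` uniform mode ✓
numerically — LOCATED-PD-TILE-CRITERION §4); `hker` at the record, stub 1, K0⁷ ∕ K1⁸ NOT closed; N07 not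
discharged; nothing continuum ∕ OS ∕ mass gap.  Context only (no hypothesis is a citation): T. Bałaban, CMP **109**
(1987) 249–301 [Balaban1987RG1] (0.4) (block averaging at centres); CMP **96** (1984) 223–250
[Balaban1984PropagatorsII] (2.22).
-/

set_option autoImplicit false

noncomputable section

open Finset

namespace Summit.QuantumFields.YangMills.Theorems.N07PointFeasibilityEnergyIdentity

open Literature.Probability.LatticeModels (TorusSite)

variable {d N : ℕ} {𝕜 : Type*} [CommRing 𝕜]

/-! ## §1  Finite-difference calculus on the torus `(ℤ∕N)^d` -/

/-- Forward difference along the `i`-th unit vector: `∂ᵢ f x = f (x + eᵢ) − f x`. [folklore] -/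
def fd (i : Fin d) (f : TorusSite d N → 𝕜) (x : TorusSite d N) : 𝕜 :=
  f (x + Pi.single i 1) - f x

/-- Backward difference along the `i`-th unit vector: `∂ᵢ⁻ f x = f x − f (x − eᵢ)`. [folklore] -/
def bd (i : Fin d) (f : TorusSite d N → 𝕜) (x : TorusSite d N) : 𝕜 :=
  f x - f (x - Pi.single i 1)

/-- The lattice Laplacian on the torus acting on functions: `Δ f x = Σᵢ (f (x + eᵢ) + f (x − eᵢ) − 2 f x)`, steps
`Pi.single i 1`, any coefficient ring (cf. the real MATRIX form over `Dir d` of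
`Literature.Barriers.CriticalPhenomena.WeaklySAWTorusFeynmanKac.torusLaplacian`, not imported here). [folklore] -/
def lap (f : TorusSite d N → 𝕜) (x : TorusSite d N) : 𝕜 :=
  ∑ i, (f (x + Pi.single i 1) + f (x - Pi.single i 1) - 2 * f x)

/-- The backward difference is a shifted forward difference: `∂ᵢ⁻ f x = ∂ᵢ f (x − eᵢ)`. [folklore] -/
theorem bd_eq_fd_sub (i : Fin d) (f : TorusSite d N → 𝕜) (x : TorusSite d N) :
    bd i f x = fd i f (x - Pi.single i 1) := by
  simp only [bd, fd, sub_add_cancel]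

/-- Forward differences commute. [folklore] -/
theorem fd_comm (i j : Fin d) (f : TorusSite d N → 𝕜) : fd i (fd j f) = fd j (fd i f) := by
  funext x
  simp only [fd, add_right_comm x (Pi.single i 1) (Pi.single j 1)]
  ring

/-- Forward and backward differences commute. [folklore] -/
theorem fd_bd_comm (i j : Fin d) (f : TorusSite d N → 𝕜) : fd i (bd j f) = bd j (fd i f) := by
  funext x
  simp only [fd, bd, sub_add_eq_add_sub, add_sub_assoc]
  ring_nf

/-- The Laplacian is the sum of the second differences `∂ᵢ⁻∂ᵢ`. [folklore] -/
theorem lap_eq_sum_bd_fd (f : TorusSite d N → 𝕜) (x : TorusSite d N) :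
    lap f x = ∑ i, bd i (fd i f) x := by
  refine Finset.sum_congr rfl (fun i _ => ?_)
  simp only [bd, fd, sub_add_cancel]
  ring

/-- The Laplacian of a constant vanishes. [folklore] -/
theorem lap_const (c : 𝕜) (x : TorusSite d N) : lap (fun _ : TorusSite d N => c) x = 0 :=
  Finset.sum_eq_zero (fun i _ => by ring)

section Sums

variable [NeZero N]

/-- Translation invariance of torus sums: `Σ_x f (x + v) = Σ_x f x`. [folklore] -/
theorem sum_shift {M : Type*} [AddCommMonoid M] (f : TorusSite d N → M) (v : TorusSite d N) :
    ∑ x, f (x + v) = ∑ x, f x :=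
  Fintype.sum_equiv (Equiv.addRight v) _ _ (fun _ => rfl)

/-- `Σ_x f (x − v) = Σ_x f x`. [folklore] -/
theorem sum_shift_sub {M : Type*} [AddCommMonoid M] (f : TorusSite d N → M) (v : TorusSite d N) :
    ∑ x, f (x - v) = ∑ x, f x :=
  Fintype.sum_equiv (Equiv.subRight v) _ _ (fun _ => rfl)

/-- **Summation by parts**: `Σ_x (∂ᵢ f x)·g x = −Σ_x f x·(∂ᵢ⁻ g x)`. [folklore] -/
theorem sum_fd_mul (i : Fin d) (f g : TorusSite d N → 𝕜) :
    ∑ x, fd i f x * g x = -∑ x, f x * bd i g x := by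
  have h := sum_shift (fun x => f x * g (x - Pi.single i 1)) (Pi.single i 1)
  simp only [add_sub_cancel_right] at h
  simp only [fd, bd, sub_mul, mul_sub, Finset.sum_sub_distrib, ← h]
  ring

/-- **Summation by parts**, second form: `Σ_x f x·(∂ᵢ g x) = −Σ_x (∂ᵢ⁻ f x)·g x`. [folklore] -/
theorem sum_mul_fd (i : Fin d) (f g : TorusSite d N → 𝕜) :
    ∑ x, f x * fd i g x = -∑ x, bd i f x * g x := by
  have h := sum_fd_mul i g f
  have e1 : ∑ x, f x * fd i g x = ∑ x, fd i g x * f x := Finset.sum_congr rfl (fun x _ => mul_comm _ _)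
  have e2 : ∑ x, bd i f x * g x = ∑ x, g x * bd i f x := Finset.sum_congr rfl (fun x _ => mul_comm _ _)
  rw [e1, e2, h]

/-- **Polarised Dirichlet form**: `Σ_x f x·Δg x = −Σᵢ Σ_x (∂ᵢ f x)(∂ᵢ g x)`. [folklore] -/
theorem sum_mul_lap (f g : TorusSite d N → 𝕜) :
    ∑ x, f x * lap g x = -∑ i, ∑ x, fd i f x * fd i g x := by
  simp only [lap_eq_sum_bd_fd, Finset.mul_sum]
  rw [Finset.sum_comm, ← Finset.sum_neg_distrib]
  refine Finset.sum_congr rfl (fun i _ => ?_)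
  rw [sum_fd_mul i f (fd i g), neg_neg]

/-- ★ **The Laplacian is symmetric**: `Σ_x f x·Δg x = Σ_x Δf x·g x`. [folklore] -/
theorem sum_mul_lap_comm (f g : TorusSite d N → 𝕜) :
    ∑ x, f x * lap g x = ∑ x, lap f x * g x := by
  rw [sum_mul_lap, show ∑ x, lap f x * g x = ∑ x, g x * lap f x from
    Finset.sum_congr rfl (fun x _ => mul_comm _ _), sum_mul_lap]
  exact congrArg Neg.neg (Finset.sum_congr rfl (fun i _ =>
    Finset.sum_congr rfl (fun x _ => mul_comm _ _)))

/-- The Laplacian kills constants, so `Σ_x Δf x = 0`. [folklore] -/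
theorem sum_lap (f : TorusSite d N → 𝕜) : ∑ x, lap f x = 0 := by
  have h := sum_mul_lap_comm (fun _ => (1 : 𝕜)) f
  simpa only [one_mul, lap_const, zero_mul, Finset.sum_const_zero] using h

/-- **Dirichlet form**: `Σ_x f x·Δf x = −Σᵢ Σ_x (∂ᵢ f x)²`. [folklore] -/
theorem sum_mul_lap_self (f : TorusSite d N → 𝕜) :
    ∑ x, f x * lap f x = -∑ i, ∑ x, fd i f x ^ 2 := by
  simp only [sum_mul_lap, sq]

/-- ★★ **The Hessian identity** (forward-corner split): `Σ_x (Δf x)² = Σ_x Σᵢ Σⱼ (∂ᵢ∂ⱼ f x)²` — two summations by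
parts and the commutation of differences.  It makes the energy `‖Δf‖²` a sum of NON-NEGATIVE LOCAL densities
`e(x) = Σ_{i,j} (∂ᵢ∂ⱼ f x)²` (LOCATED-PD-TILE-CRITERION §2). [folklore] -/
theorem sum_lap_sq_eq_sum_hess_sq (f : TorusSite d N → 𝕜) :
    ∑ x, lap f x ^ 2 = ∑ x, ∑ i, ∑ j, fd i (fd j f) x ^ 2 := by
  have key : ∀ i j : Fin d,
      ∑ x, bd i (fd i f) x * bd j (fd j f) x = ∑ x, fd i (fd j f) x ^ 2 := by
    intro i j
    have s1 : ∑ x, bd i (fd i f) x * bd j (fd j f) x = -∑ x, fd j (bd i (fd i f)) x * fd j f x := by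
      rw [sum_fd_mul, neg_neg]
    have s2 : fd j (bd i (fd i f)) = bd i (fd i (fd j f)) := by
      rw [fd_bd_comm, fd_comm]
    have s3 : ∑ x, bd i (fd i (fd j f)) x * fd j f x = -∑ x, fd i (fd j f) x * fd i (fd j f) x := by
      rw [sum_mul_fd i (fd i (fd j f)) (fd j f), neg_neg]
    rw [s1, s2, s3, neg_neg]
    exact Finset.sum_congr rfl (fun x _ => by ring)
  calc ∑ x, lap f x ^ 2 = ∑ x, (∑ i, bd i (fd i f) x) * (∑ j, bd j (fd j f) x) := by
        refine Finset.sum_congr rfl (fun x _ => ?_); rw [sq, lap_eq_sum_bd_fd]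
    _ = ∑ x, ∑ i, ∑ j, bd i (fd i f) x * bd j (fd j f) x := by
        refine Finset.sum_congr rfl (fun x _ => ?_); rw [Finset.sum_mul_sum]
    _ = ∑ i, ∑ j, ∑ x, bd i (fd i f) x * bd j (fd j f) x := by
        rw [Finset.sum_comm]; refine Finset.sum_congr rfl (fun i _ => ?_); rw [Finset.sum_comm]
    _ = ∑ i, ∑ j, ∑ x, fd i (fd j f) x ^ 2 := by simp only [key]
    _ = ∑ i, ∑ x, ∑ j, fd i (fd j f) x ^ 2 := Finset.sum_congr rfl (fun i _ => Finset.sum_comm)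
    _ = ∑ x, ∑ i, ∑ j, fd i (fd j f) x ^ 2 := Finset.sum_comm

/-- Re-centring the diagonal: `Σ_x (∂ᵢ∂ᵢ f x)² = Σ_x (∂ᵢ⁻∂ᵢ f x)²` (the symmetric second difference). [folklore] -/
theorem sum_fd_fd_sq_eq_sum_bd_fd_sq (i : Fin d) (f : TorusSite d N → 𝕜) :
    ∑ x, fd i (fd i f) x ^ 2 = ∑ x, bd i (fd i f) x ^ 2 := by
  simp only [bd_eq_fd_sub]
  exact (sum_shift_sub (fun x => fd i (fd i f) x ^ 2) (Pi.single i 1)).symm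

end Sums

/-! ## §2  Rigidity: difference-free, Hessian-free and (bi)harmonic functions on the torus are constant -/

section Rigidity

/-- `m • eᵢ = Pi.single i m` on the torus. [folklore] -/
theorem nsmul_single_one (i : Fin d) (m : ℕ) :
    m • (Pi.single i (1 : ZMod N) : TorusSite d N) = Pi.single i (m : ZMod N) := by
  ext l
  rcases eq_or_ne l i with rfl | h
  · simp
  · simp [Pi.single_eq_of_ne h]

/-- If `∂ᵢ f ≡ 0` then `f` is invariant under `y ↦ y + m eᵢ`. [folklore] -/
theorem apply_add_nsmul_of_fd_eq_zero {f : TorusSite d N → 𝕜} {i : Fin d} (h : ∀ x, fd i f x = 0)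
    (y : TorusSite d N) (m : ℕ) : f (y + m • Pi.single i 1) = f y := by
  induction m with
  | zero => simp
  | succ m ih =>
      have hy := h (y + m • Pi.single i 1)
      rw [fd, sub_eq_zero] at hy
      rw [succ_nsmul, ← add_assoc, hy, ih]

variable [NeZero N]

/-- **A function all of whose forward differences vanish is constant** (the grid is connected). [folklore] -/
theorem eq_of_fd_eq_zero {f : TorusSite d N → 𝕜} (h : ∀ i x, fd i f x = 0) (x : TorusSite d N) :
    f x = f 0 := by
  classical
  have key : ∀ s : Finset (Fin d), ∀ y : TorusSite d N, f (y + ∑ i ∈ s, Pi.single i (x i)) = f y := by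
    intro s
    induction s using Finset.induction_on with
    | empty => intro y; simp
    | insert a s ha ih =>
        intro y
        rw [Finset.sum_insert ha, ← add_assoc, add_right_comm, ← ZMod.natCast_zmod_val (x a),
          ← nsmul_single_one, apply_add_nsmul_of_fd_eq_zero (h a), ih]
  have hx : x = 0 + ∑ i ∈ Finset.univ, Pi.single i (x i) := by
    rw [zero_add, Finset.univ_sum_single]
  conv_lhs => rw [hx]
  exact key Finset.univ 0

/-- ★ **A Hessian-free function on the torus is constant**: if `∂ᵢ∂ⱼ f ≡ 0` for all `i, j`, then `f` is
constant.  (From `∂ᵢ∂ᵢ f = 0`, `∂ᵢ f` is constant along the `i`-cycle; its sum over the cycle telescopes to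
`f (y + N eᵢ) − f y = 0`, so `N • ∂ᵢ f y = 0`, and `N ≠ 0` in characteristic zero.)  Over a field of
characteristic zero. [folklore] -/
theorem const_of_hess_eq_zero {𝕂 : Type*} [Field 𝕂] [CharZero 𝕂] {f : TorusSite d N → 𝕂}
    (h : ∀ i j x, fd i (fd j f) x = 0) (x : TorusSite d N) : f x = f 0 := by
  refine eq_of_fd_eq_zero (fun i y => ?_) x
  have hconst : ∀ m : ℕ, fd i f (y + m • Pi.single i 1) = fd i f y :=
    fun m => apply_add_nsmul_of_fd_eq_zero (h i i) y m
  have htel' : ∀ n : ℕ, ∑ m ∈ Finset.range n, fd i f (y + m • Pi.single i 1) =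
      f (y + n • Pi.single i 1) - f y := by
    intro n
    induction n with
    | zero => simp
    | succ n ih =>
        rw [Finset.sum_range_succ, ih, fd, succ_nsmul, ← add_assoc]
        ring
  have htel := htel' N
  rw [nsmul_single_one, ZMod.natCast_self, Pi.single_zero, add_zero, sub_self] at htel
  simp only [hconst, Finset.sum_const, Finset.card_range] at htel
  rw [nsmul_eq_mul, mul_eq_zero] at htel
  exact htel.resolve_left (Nat.cast_ne_zero.2 (NeZero.ne N))

/-- **A harmonic function on the torus is constant** (real case, via the Dirichlet form). [folklore] -/
theorem const_of_lap_eq_zero {f : TorusSite d N → ℝ} (h : ∀ x, lap f x = 0) (x : TorusSite d N) :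
    f x = f 0 := by
  refine eq_of_fd_eq_zero (fun i y => ?_) x
  have hD : ∑ i, ∑ x, fd i f x ^ 2 = 0 := by
    have := sum_mul_lap_self f
    simp only [h, mul_zero, Finset.sum_const_zero] at this
    linarith
  have hi := (Finset.sum_eq_zero_iff_of_nonneg (fun i _ =>
    Finset.sum_nonneg (fun x _ => sq_nonneg (fd i f x)))).1 hD i (Finset.mem_univ i)
  have hy := (Finset.sum_eq_zero_iff_of_nonneg (fun x _ => sq_nonneg (fd i f x))).1 hi y
    (Finset.mem_univ y)
  exact pow_eq_zero_iff (n := 2) (by norm_num) |>.1 hy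

/-- **A biharmonic function on the torus is constant** (real): `Δ²f = 0 ⇒ ‖Δf‖² = Σ f·Δ²f = 0`. [folklore] -/
theorem const_of_lap_lap_eq_zero {f : TorusSite d N → ℝ} (h : ∀ x, lap (lap f) x = 0)
    (x : TorusSite d N) : f x = f 0 := by
  refine const_of_lap_eq_zero (fun y => ?_) x
  have hE : ∑ x, lap f x ^ 2 = 0 := by
    have e := sum_mul_lap_comm f (lap f)
    simp only [h, mul_zero, Finset.sum_const_zero] at e
    rw [show ∑ x, lap f x ^ 2 = ∑ x, lap f x * lap f x from
      Finset.sum_congr rfl (fun x _ => sq (lap f x)), ← e]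
  have hy := (Finset.sum_eq_zero_iff_of_nonneg (fun x _ => sq_nonneg (lap f x))).1 hE y
    (Finset.mem_univ y)
  exact pow_eq_zero_iff (n := 2) (by norm_num) |>.1 hy

end Rigidity

/-! ## §3  Tilings with centres: the energy identity and «cluster criterion ⇒ (P)_D» -/

section Tiling

variable [NeZero N] {τ : Type*} (tile : TorusSite d N → τ) (ctr : τ → TorusSite d N)

/-- ★★ **The energy identity** (LOCATED-PD-TILE-CRITERION §2, torus form).  For ANY "tiling"
`tile : TorusSite d N → τ` with "centres" `ctr : τ → TorusSite d N`: if `μ` takes one value `h` on all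
centres and `Δ²μ x = β (tile x)` is tile-wise constant, then
`‖Δμ‖² = Σ_x β(tile x)·(μ x − μ(ctr (tile x)))` (`= Σ_B β_B·(Σ_{x∈B} μ − |B| μ(c_B))`).  Proof:
`‖Δμ‖² = Σ μ·Δ²μ` (symmetry of `Δ`) and `Σ_x β(tile x) = Σ_x Δ²μ x = 0` pays for the centre term. [folklore] -/
theorem energy_identity {μ : TorusSite d N → 𝕜} {β : τ → 𝕜} {h : 𝕜} (hc : ∀ t, μ (ctr t) = h)
    (hβ : ∀ x, lap (lap μ) x = β (tile x)) :
    ∑ x, lap μ x ^ 2 = ∑ x, β (tile x) * (μ x - μ (ctr (tile x))) := by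
  have h0 : ∑ x, β (tile x) = 0 := by
    rw [← sum_lap (lap μ)]
    exact Finset.sum_congr rfl (fun x _ => (hβ x).symm)
  have h1 : ∑ x, lap μ x ^ 2 = ∑ x, μ x * β (tile x) := by
    rw [show ∑ x, lap μ x ^ 2 = ∑ x, lap μ x * lap μ x from
      Finset.sum_congr rfl (fun x _ => sq (lap μ x)), ← sum_mul_lap_comm μ (lap μ)]
    exact Finset.sum_congr rfl (fun x _ => by rw [hβ x])
  simp only [hc, mul_sub, Finset.sum_sub_distrib, ← Finset.sum_mul, h0, zero_mul, sub_zero, h1]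
  exact Finset.sum_congr rfl (fun x _ => mul_comm _ _)

/-- ★★ **The energy identity, Hessian form**: under the same hypotheses,
`Σ_x Σ_{i,j} (∂ᵢ∂ⱼ μ x)² = Σ_x β(tile x)·(μ x − μ(ctr (tile x)))` — the left side is a sum of non-negative
LOCAL densities (real case), which is what makes tile ∕ cluster budgets possible. [folklore] -/
theorem energy_identity_hess {μ : TorusSite d N → 𝕜} {β : τ → 𝕜} {h : 𝕜} (hc : ∀ t, μ (ctr t) = h)
    (hβ : ∀ x, lap (lap μ) x = β (tile x)) :
    ∑ x, ∑ i, ∑ j, fd i (fd j μ) x ^ 2 = ∑ x, β (tile x) * (μ x - μ (ctr (tile x))) := by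
  rw [← sum_lap_sq_eq_sum_hess_sq, energy_identity tile ctr hc hβ]

/-- ★★★ **Local criterion ⇒ (P)_D** (LOCATED-PD-TILE-CRITERION §3, nesting-agnostic, ANY energy split).  Let
`e ≥ 0`-type densities be any `e : TorusSite d N → ℝ` with `Σ_x e x = ‖Δμ‖²` (e.g. `e x = (Δμ x)²`, or the Hessian
split of `sum_lap_sq_eq_sum_hess_sq`, or its re-centred diagonal), and group the sites by ANY `clu : TorusSite d N → σ`.
If at `μ` every cluster functional `Φ_s(μ) = Σ_{clu x = s} (e x − β(tile x)·(μ x − μ(ctr (tile x))))` is `≥ 0` and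
vanishes only when `Δμ = 0` on the cluster, then a `μ` with one value on all centres and tile-wise constant `Δ²μ` is
CONSTANT (`Σ_s Φ_s = 0` by the energy identity ⇒ every `Φ_s = 0` ⇒ `Δμ ≡ 0` ⇒ constant). [folklore] -/
theorem pointFeasibility_of_localCriterion {σ : Type*} [Fintype σ] [DecidableEq σ]
    (clu : TorusSite d N → σ) {μ : TorusSite d N → ℝ} {β : τ → ℝ} {h : ℝ} (hc : ∀ t, μ (ctr t) = h)
    (hβ : ∀ x, lap (lap μ) x = β (tile x)) (e : TorusSite d N → ℝ) (he : ∑ x, e x = ∑ x, lap μ x ^ 2)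
    (hcrit : ∀ s : σ,
      0 ≤ ∑ x ∈ Finset.univ.filter (fun x => clu x = s), (e x - β (tile x) * (μ x - μ (ctr (tile x)))) ∧
      (∑ x ∈ Finset.univ.filter (fun x => clu x = s), (e x - β (tile x) * (μ x - μ (ctr (tile x)))) = 0 →
        ∀ x, clu x = s → lap μ x = 0))
    (x : TorusSite d N) : μ x = h := by
  set F : TorusSite d N → ℝ := fun x => e x - β (tile x) * (μ x - μ (ctr (tile x))) with hF
  have htot : ∑ s, ∑ x ∈ Finset.univ.filter (fun x => clu x = s), F x = 0 := by
    rw [Finset.sum_fiberwise (s := Finset.univ) (g := clu) (f := F)]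
    simp only [hF, Finset.sum_sub_distrib, he, energy_identity tile ctr hc hβ, sub_self]
  have hall : ∀ s, ∑ x ∈ Finset.univ.filter (fun x => clu x = s), F x = 0 := fun s =>
    (Finset.sum_eq_zero_iff_of_nonneg (fun s _ => (hcrit s).1)).1 htot s (Finset.mem_univ s)
  have hlap : ∀ z, lap μ z = 0 := fun z => (hcrit (clu z)).2 (hall (clu z)) z rfl
  rw [const_of_lap_eq_zero hlap x, ← const_of_lap_eq_zero hlap (ctr (tile x)), hc]

/-- ★★★ **Cluster criterion ⇒ (P)_D** (LOCATED-PD-TILE-CRITERION §3, nesting-agnostic).  Group the sites by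
ANY map `clu : TorusSite d N → σ` ("clusters"; e.g. `clu = tile`, or unions of tiles).  If at `μ` every cluster
functional
`Φ_s(μ) = Σ_{clu x = s} (Σ_{i,j} (∂ᵢ∂ⱼ μ x)² − β(tile x)·(μ x − μ(ctr (tile x))))`
is non-negative, and vanishes only when the Hessian of `μ` vanishes on the cluster, then a `μ` with one
value on all centres and tile-wise constant `Δ²μ` is CONSTANT.  (`Σ_s Φ_s = 0` by the energy identity, so
every `Φ_s = 0`, so `μ` is Hessian-free, hence constant.)  The criterion is asked at `μ` only; the lane
note's (C_{ℓ,d}) ∕ (C^clu_{ℓ,k,d}) are its uniform-in-`μ` versions per tile ∕ cluster shape. [folklore] -/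
theorem pointFeasibility_of_clusterCriterion {σ : Type*} [Fintype σ] [DecidableEq σ]
    (clu : TorusSite d N → σ) {μ : TorusSite d N → ℝ} {β : τ → ℝ} {h : ℝ} (hc : ∀ t, μ (ctr t) = h)
    (hβ : ∀ x, lap (lap μ) x = β (tile x))
    (hcrit : ∀ s : σ,
      0 ≤ ∑ x ∈ Finset.univ.filter (fun x => clu x = s),
          (∑ i, ∑ j, fd i (fd j μ) x ^ 2 - β (tile x) * (μ x - μ (ctr (tile x)))) ∧
      (∑ x ∈ Finset.univ.filter (fun x => clu x = s),
          (∑ i, ∑ j, fd i (fd j μ) x ^ 2 - β (tile x) * (μ x - μ (ctr (tile x)))) = 0 →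
        ∀ x, clu x = s → ∀ i j, fd i (fd j μ) x = 0))
    (x : TorusSite d N) : μ x = h := by
  set F : TorusSite d N → ℝ :=
    fun x => ∑ i, ∑ j, fd i (fd j μ) x ^ 2 - β (tile x) * (μ x - μ (ctr (tile x))) with hF
  have htot : ∑ s, ∑ x ∈ Finset.univ.filter (fun x => clu x = s), F x = 0 := by
    rw [Finset.sum_fiberwise (s := Finset.univ) (g := clu) (f := F)]
    simp only [hF, Finset.sum_sub_distrib, energy_identity_hess tile ctr hc hβ, sub_self]
  have hall : ∀ s, ∑ x ∈ Finset.univ.filter (fun x => clu x = s), F x = 0 := fun s =>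
    (Finset.sum_eq_zero_iff_of_nonneg (fun s _ => (hcrit s).1)).1 htot s (Finset.mem_univ s)
  have hhess : ∀ i j z, fd i (fd j μ) z = 0 := fun i j z =>
    (hcrit (clu z)).2 (hall (clu z)) z rfl i j
  rw [const_of_hess_eq_zero hhess x, ← const_of_hess_eq_zero hhess (ctr (tile x)), hc]

/-- ★★★ **K-positivity ⇒ (P)_D** (the one-cluster, global form): if, whenever `Δμ ≢ 0`, the centre defect
`Σ_x β(tile x)·(μ x − μ(ctr (tile x)))` is STRICTLY below the energy `‖Δμ‖²`, then a `μ` with one value on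
all centres and tile-wise constant `Δ²μ` is constant.  (In the matrix language of the lane thread: with `A`
the clamped bilaplacian and `K_{B,B′} = |B|·(A⁻¹1_{B′})(c_B)`, (P)_D ⇔ `K` nonsingular, and this hypothesis is
`sym K ≻ 0` evaluated at one vector.) [folklore] -/
theorem pointFeasibility_of_kPositivity {μ : TorusSite d N → ℝ} {β : τ → ℝ} {h : ℝ}
    (hc : ∀ t, μ (ctr t) = h) (hβ : ∀ x, lap (lap μ) x = β (tile x))
    (hK : 0 < ∑ x, lap μ x ^ 2 →
      ∑ x, β (tile x) * (μ x - μ (ctr (tile x))) < ∑ x, lap μ x ^ 2)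
    (x : TorusSite d N) : μ x = h := by
  have hid := energy_identity tile ctr hc hβ
  have hzero : ∑ x, lap μ x ^ 2 = 0 := by
    by_contra hne
    have hpos : 0 < ∑ x, lap μ x ^ 2 :=
      lt_of_le_of_ne (Finset.sum_nonneg (fun x _ => sq_nonneg (lap μ x))) (Ne.symm hne)
    have := hK hpos
    rw [hid] at this
    exact lt_irrefl _ this
  have hlap : ∀ z, lap μ z = 0 := fun z =>
    pow_eq_zero_iff (n := 2) (by norm_num) |>.1
      ((Finset.sum_eq_zero_iff_of_nonneg (fun x _ => sq_nonneg (lap μ x))).1 hzero z (Finset.mem_univ z))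
  rw [const_of_lap_eq_zero hlap x, ← const_of_lap_eq_zero hlap (ctr (tile x)), hc]

end Tiling

end Summit.QuantumFields.YangMills.Theorems.N07PointFeasibilityEnergyIdentity

end
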